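import Summits.Ventures.HodgeRepro2.T5SU11ReductionOfOrderAsymptotic

/-!
# Tails of integrals compared: `h/k → C` implies `(∫_t^∞ h)/(∫_t^∞ k) → C`, and the power-tail case `t ∫_t^∞ h → C` when `t² h(t) → C`

Row 449 proved the exponential case `e^{bt} h(t) → C ⇒ e^{bt} ∫_t^∞ h → C/b` by a direct squeeze. This file
isolates the general principle behind it — a comparison of tails against a POSITIVE integrable kernel `k`:

  **if `k > 0` and `h, k` are integrable on `(a, ∞)` and `h(t)/k(t) → C`, then
  `(∫_t^∞ h)/(∫_t^∞ k) → C`**  (`tendsto_integral_Ioi_div`),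

because `(C − δ) k ≤ h ≤ (C + δ) k` on `(t, ∞)` for `t` large integrates to `(C − δ) K(t) ≤ H(t) ≤ (C + δ) K(t)`
with `K(t) = ∫_t^∞ k > 0` (`setIntegral_pos_iff_support_of_nonneg_ae`, the tail has infinite measure). With the
kernel `k(s) = s⁻²`, `K(t) = 1/t` (Mathlib's `integral_Ioi_rpow_of_lt`), this gives the POWER-TAIL case needed at
the spectral edge `λ = 1`: **`t² h(t) → C ⇒ t ∫_t^∞ h → C`** (`tendsto_mul_integral_Ioi_of_tendsto_sq_mul`); and
the exponential kernel reproduces row 449 (`tendsto_exp_mul_integral_Ioi'`). Nothing is claimed about (N).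

Blind lane: Mathlib + the HodgeRepro2 prefix only; no sorry; axioms ⊆ {propext, Classical.choice,
Quot.sound}.
-/

namespace Summit.Ventures.HodgeRepro2.T5SU11TailIntegralRatio

open Filter Topology MeasureTheory
open Set (Ioi)
open T5SU11ReductionOfOrderAsymptotic

/-- The tail integral of a positive integrable kernel is positive. -/
theorem integral_Ioi_pos_of_pos {k : ℝ → ℝ} {t : ℝ} (hk : IntegrableOn k (Ioi t))
    (hkpos : ∀ s, t < s → 0 < k s) : 0 < ∫ s in Ioi t, k s := by
  rw [setIntegral_pos_iff_support_of_nonneg_ae (ae_restrict_of_forall_mem measurableSet_Ioi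
    (fun s hs => (hkpos s hs).le)) hk]
  have h : Function.support k ∩ Ioi t = Ioi t := by
    ext s
    constructor
    · exact fun hs => hs.2
    · exact fun hs => ⟨(hkpos s hs).ne', hs⟩
  rw [h, Real.volume_Ioi]
  exact ENNReal.zero_lt_top

/-- **Tails compared**: `h/k → C` with `k > 0` integrable implies `(∫_t^∞ h)/(∫_t^∞ k) → C`. -/
theorem tendsto_integral_Ioi_div {h k : ℝ → ℝ} {a C : ℝ} (hk : IntegrableOn k (Ioi a))
    (hkpos : ∀ s, a < s → 0 < k s) (hh : IntegrableOn h (Ioi a))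
    (hlim : Tendsto (fun t => h t / k t) atTop (𝓝 C)) :
    Tendsto (fun t => (∫ s in Ioi t, h s) / ∫ s in Ioi t, k s) atTop (𝓝 C) := by
  rw [Metric.tendsto_atTop]
  intro ε hε
  obtain ⟨T, hT⟩ := Metric.tendsto_atTop.mp hlim (ε / 2) (by positivity)
  refine ⟨max T a, fun t ht => ?_⟩
  have htT : T ≤ t := le_trans (le_max_left _ _) ht
  have hta : a ≤ t := le_trans (le_max_right _ _) ht
  have hkt : IntegrableOn k (Ioi t) := hk.mono_set (Set.Ioi_subset_Ioi hta)
  have hht : IntegrableOn h (Ioi t) := hh.mono_set (Set.Ioi_subset_Ioi hta)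
  have hK : 0 < ∫ s in Ioi t, k s := integral_Ioi_pos_of_pos hkt (fun s hs => hkpos s (lt_of_le_of_lt hta hs))
  -- the pointwise squeeze on `(t, ∞)`
  have hpt : ∀ s ∈ Ioi t, (C - ε / 2) * k s ≤ h s ∧ h s ≤ (C + ε / 2) * k s := by
    intro s hs
    have hks : 0 < k s := hkpos s (lt_of_le_of_lt hta hs)
    have hd := hT s (le_trans htT (le_of_lt hs))
    rw [Real.dist_eq, abs_lt] at hd
    have hsplit : h s = (h s / k s) * k s := by rw [div_mul_cancel₀ _ hks.ne']
    constructor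
    · calc (C - ε / 2) * k s ≤ (h s / k s) * k s := mul_le_mul_of_nonneg_right (by linarith [hd.1]) hks.le
        _ = h s := hsplit.symm
    · calc h s = (h s / k s) * k s := hsplit
        _ ≤ (C + ε / 2) * k s := mul_le_mul_of_nonneg_right (by linarith [hd.2]) hks.le
  have hupper : ∫ s in Ioi t, h s ≤ (C + ε / 2) * ∫ s in Ioi t, k s := by
    rw [← MeasureTheory.integral_const_mul]
    exact setIntegral_mono_on hht (hkt.const_mul _) measurableSet_Ioi (fun s hs => (hpt s hs).2)
  have hlower : (C - ε / 2) * ∫ s in Ioi t, k s ≤ ∫ s in Ioi t, h s := by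
    rw [← MeasureTheory.integral_const_mul]
    exact setIntegral_mono_on (hkt.const_mul _) hht measurableSet_Ioi (fun s hs => (hpt s hs).1)
  rw [Real.dist_eq, abs_lt]
  constructor
  · have := (le_div_iff₀ hK).mpr hlower
    linarith
  · have := (div_le_iff₀ hK).mpr hupper
    linarith

/-! ### The power-tail case -/

/-- `∫_t^∞ s⁻² ds = 1/t` for `t > 0`. -/
theorem integral_Ioi_inv_sq {t : ℝ} (ht : 0 < t) : ∫ s in Ioi t, (s ^ 2)⁻¹ = t⁻¹ := by
  have h := integral_Ioi_rpow_of_lt (by norm_num : (-2 : ℝ) < -1) ht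
  have e : ∫ s in Ioi t, (s ^ 2)⁻¹ = ∫ s in Ioi t, s ^ (-2 : ℝ) := by
    refine setIntegral_congr_fun measurableSet_Ioi (fun s hs => ?_)
    have hs0 : 0 ≤ s := le_of_lt (lt_trans ht hs)
    show (s ^ 2)⁻¹ = s ^ (-2 : ℝ)
    rw [Real.rpow_neg hs0, Real.rpow_two]
  rw [e, h, show (-2 : ℝ) + 1 = -1 by norm_num, Real.rpow_neg_one]
  ring

/-- **The power-tail case**: if `h` is integrable on `(a, ∞)`, `a > 0`, and `t² h(t) → C`, then `t ∫_t^∞ h → C`. -/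
theorem tendsto_mul_integral_Ioi_of_tendsto_sq_mul {h : ℝ → ℝ} {a C : ℝ} (ha : 0 < a)
    (hh : IntegrableOn h (Ioi a)) (hlim : Tendsto (fun t => t ^ 2 * h t) atTop (𝓝 C)) :
    Tendsto (fun t => t * ∫ s in Ioi t, h s) atTop (𝓝 C) := by
  have hk : IntegrableOn (fun s : ℝ => (s ^ 2)⁻¹) (Ioi a) := by
    have := integrableOn_Ioi_rpow_of_lt (by norm_num : (-2 : ℝ) < -1) ha
    refine this.congr_fun (fun s hs => ?_) measurableSet_Ioi
    show s ^ (-2 : ℝ) = (s ^ 2)⁻¹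
    rw [Real.rpow_neg (le_of_lt (lt_trans ha hs)), Real.rpow_two]
  have hlim' : Tendsto (fun t => h t / (t ^ 2)⁻¹) atTop (𝓝 C) := by
    refine hlim.congr' ?_
    filter_upwards [eventually_gt_atTop 0] with t ht
    rw [div_inv_eq_mul, mul_comm]
  have := tendsto_integral_Ioi_div hk (fun s hs => inv_pos.mpr (pow_pos (lt_trans ha hs) 2)) hh hlim'
  refine this.congr' ?_
  filter_upwards [eventually_gt_atTop 0] with t ht
  rw [integral_Ioi_inv_sq ht, div_inv_eq_mul, mul_comm]

/-! ### The exponential case, re-derived -/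

/-- Row 449's exponential case from the general principle: `e^{bt} h(t) → C ⇒ e^{bt} ∫_t^∞ h → C/b`. -/
theorem tendsto_exp_mul_integral_Ioi' {h : ℝ → ℝ} {a b C : ℝ} (hb : 0 < b) (hint : IntegrableOn h (Ioi a))
    (hlim : Tendsto (fun t => Real.exp (b * t) * h t) atTop (𝓝 C)) :
    Tendsto (fun t => Real.exp (b * t) * ∫ s in Ioi t, h s) atTop (𝓝 (C / b)) := by
  have hlim' : Tendsto (fun t => h t / Real.exp (-b * t)) atTop (𝓝 C) := by
    refine hlim.congr' (Eventually.of_forall fun t => ?_)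
    show Real.exp (b * t) * h t = h t / Real.exp (-b * t)
    rw [div_eq_mul_inv, ← Real.exp_neg, mul_comm, neg_mul, neg_neg]
  have := (tendsto_integral_Ioi_div (exp_neg_integrableOn_Ioi a hb) (fun s _ => Real.exp_pos _) hint hlim').div_const b
  refine this.congr' (Eventually.of_forall fun t => ?_)
  show (∫ s in Ioi t, h s) / (∫ s in Ioi t, Real.exp (-b * s)) / b = Real.exp (b * t) * ∫ s in Ioi t, h s
  rw [integral_exp_neg_mul_Ioi hb]
  have hE : Real.exp (b * t) * Real.exp (-b * t) = 1 := by
    rw [← Real.exp_add, show b * t + -b * t = 0 by ring, Real.exp_zero]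
  have hE0 : Real.exp (-b * t) ≠ 0 := (Real.exp_pos _).ne'
  rw [div_div, div_mul_cancel₀ _ hb.ne', div_eq_iff hE0]
  linear_combination (-(∫ s in Ioi t, h s)) * hE

end Summit.Ventures.HodgeRepro2.T5SU11TailIntegralRatio
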